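import Summits.HodgeConjecture.HodgeConjecture.Theorems.F0P6aSerreTensorFibreMarkedAtSiegelPoint      -- ★ p850866 DEAL #42 (§2 the eight names; brings ★ σ1-UNPACK p850665)
import Summits.HodgeConjecture.HodgeConjecture.Theorems.F0P6aSpecialFibreConjugationCentralTwist    -- ★ p850737 (R-CM-1)+(R-CM-2) `exists_cmConjHom_intertwines_of_centralTwist`
import Literature.AlgebraicGeometry.ShimuraVarieties.UnitaryShimuraCanonicalModelArtin               -- ★ `exists_finiteIdele_isArtinCorrespondent_algEquiv` (an `F`-correspondent of `σ`)
import Literature.AlgebraicGeometry.ShimuraVarieties.UnitaryGroupDiagonalTwistExists                  -- ★ `exists_isDiagTwistGS_recipFactor'` (the diagonal twist `d` at `w`)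
import Literature.AlgebraicGeometry.ShimuraVarieties.UnitaryShimuraCurveHeckeDescent                  -- ★ `hermForm_self_ne_zero_of_embedding_mem_negCone`
import Literature.AlgebraicGeometry.ShimuraVarieties.UnitaryAuxiliaryTorusReflexNorm                 -- ★ `Aux.reflexNormFiniteIdele_mem_torusFinAdelic` (`t(sE) ∈ T(𝔸_f)`)
import Literature.AlgebraicGeometry.Motives.GaloisThickening                                         -- ★ `thickeningLift` (`ℓ_e`), `thickeningLift_left_comp_fst∕snd`
import HarnessLib

/-!
# (B3-SRC) — THE (R-CM) INPUTS AT A SPECIAL SHEET POINT: ★ p850737 with ALL its hypotheses discharged from the LEG-E frame՚s binders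
# ([Shimura 1998] §18.6; [Milne 2005] Def. 12.8, Thm. 13.6, §14 Prop. 14.12; RSZ §3.2)

Cell `hodgecm-mathlib` (D-0151), FLOOR 0, P6 «MOD programme», crux hLiu418 (stmt-HodgeConjecture-24832, `--supports`, count-neutral), line «L4», closer
`Lines/F0_P6a_StubESHEET.lean` ∕ glue leaf `Lines/F0_P6a_StubESHEETGlobalGlue.lean` (LA7-p01 (g4) frame v1 709ce1f8), socket (B3) `OrganB3` («the tuple iso intertwines the
actions at one special sheet point per component»; pen ruling v2 LA4-plan (g2) 2026-09-02 09:59:53Z (5): `organB3` → LA6-p02 (g3) via ★ p850815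
`SiegelAdelicMarking.pullback_map_comp_eq_of_lifts_of_globalIso`, **(B3-SRC) → LA4-p03 (g3)**, `hpt` → LA4-p04 (g4) ★ `UnitaryShimuraCurveSpecialSheetPointTwist`).

**(B3-SRC) `exists_cmConjHom_at_specialSheetPoint`.**  INPUT = the `OrganB3` binders (chart `C` pinned on `Fr`, slice `ε`, action `ρ` with `RingActionReading C ε ρ`,
`γ₁ ∈ Gal(Fᵢ∕F)`, the junction `IsSheetTwistOf ι₁ τE Φ hΦ C.N γ₁ 𝔞 n` UNFOLDED into its witnesses `(γ̃, sE, z)` — its `def` lives in the Lines closer, not importable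
here — the Serre presentation rows `(E′, P_m, Q_m; ν)`, a sheet `eE = τE`, a special point `(w, a)`).  OUTPUT, at the TARGET sheet point `x₂ := ℓ_{eE}(pts⁻¹[ι₁w, a])` and
the SOURCE sheet point `x₁ := ℓ_{eE}(pts⁻¹[ι₁w, d⁻¹·a])`: the Galois element `σ := γ̃` over `ℚ` (`σ|_{ι₁F} = id`, `σ ∘ eE = eE ∘ γ₁`), an `F`-correspondent `s ↔ σ`
(★ `exists_finiteIdele_isArtinCorrespondent_algEquiv`), the diagonal twist `d` at `w` (★ `exists_isDiagTwistGS_recipFactor'`); σ1՚s principal marking `m₁` of `P_{x₁}`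
with `Θ₁, Λ₁` and its readings (★ p850866 §2 at `x₁`); the EIGHT NAMES of the Serre-tensor fibre `B_{x₂}` (★ p850866 §2 at `x₂`: `m₀, Θ₂, Λ₂, Z₂, r₂ ∈ K_δ(1), m₂, q′, qm,
M₂` with their clauses); and THE CM HOMOMORPHISM `f : (P_{x₁})^σ ⟶ B_{x₂}` with `k ∈ K_δ(N)`, the twisted torsion reading `hf` and the intertwining
`conj σ (ρ(b)_{x₁}) ≫ f = f ≫ (serreAction ρ E′ hE′ b)_{x₂}` for ALL `b ∈ 𝒪_F` (★ p850737 at `a₀ := d⁻¹·a`, `A₂ := B_{x₂}`, `act₂ b := ((serreAction …).i b)_{x₂}`) —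
EXACTLY the `(σ, h₁, Λ₁, m₁, hΛ₁, hr, hZ, m₂, f, hk, hf, F := ρ.i b, F′ := (serreAction …).i b, hint)` binders of ★ p850815 at `s := x₁`, `s′ := x₂`, leaving to `organB3`
only `hpt` (LA4-p04), `(Θ₂, hΘ₂, Λ₂, hΛ₂)` (#41 letters ★ p850830 on the names below) and `(E, hlam, hlvl)` (LEG-E).
HONEST LABEL: HC_CM is proved only modulo the 7 printed citations (2 remaining: hLiu418 24832, h413 24833) until rung 0 closes; this file closes no statement item.

## References
* [Shimura1998] G. Shimura, *Abelian Varieties with Complex Multiplication and Modular Functions* (1998), §18.6 pp. 124–128.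
* [Milne2005ShimuraVarieties] J. S. Milne, *Introduction to Shimura varieties* (2005), Def. 12.8 (59)–(62) p. 114, Thm. 13.6 p. 118, §14 Prop. 14.12 p. 125.
* [RapoportSmithlingZhang2020Diagonal] M. Rapoport, B. Smithling, W. Zhang (2020), §3.2 p. 11.
* [Deligne1979ShimuraVarieties] P. Deligne, *Variétés de Shimura* (1979), 2.2.5.
-/

set_option autoImplicit false

noncomputable section

namespace Summit.HodgeConjecture.HodgeConjecture.Theorems.F0P6aSpecialSheetPointCMHom

set_option linter.dupNamespace false  -- `Summit.HodgeConjecture.HodgeConjecture.…` BY DESIGN (D-0017)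

open CategoryTheory CategoryTheory.Limits NumberField IsDedekindDomain MulAction Matrix AlgebraicGeometry
open scoped Matrix ComplexOrder MonObj nonZeroDivisors
open Literature.AlgebraicGeometry.Motives (SchemeOver AlgPoints ComplexPoints specOver thickeningLift)
open Literature.AlgebraicGeometry.Motives.AbelianVariety (bcSpec)
open Literature.AlgebraicGeometry.AbelianSchemes (PolarizedAbelianSchemeWithLevel AbelianSchemeOver)
open Literature.AlgebraicGeometry.AbelianSchemes.AbelianSchemeOver (serreTensor serreTranslate serreAction isMonHom_serreTranslate baseChangeHom fibreHom)
open Literature.AlgebraicGeometry.ModuliOfAbelianVarieties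
open Literature.AlgebraicGeometry.ShimuraVarieties Literature.AlgebraicGeometry.ShimuraVarieties.UnitaryCanonicalModel
open Literature.AlgebraicGeometry.ShimuraVarieties.UnitaryCurve Literature.AlgebraicGeometry.ShimuraVarieties.UnitaryCurve.AuxV
open Literature.NumberTheory.Automorphic Literature.NumberTheory.Automorphic.UnitaryGroup
open Literature.NumberTheory.Automorphic.Liu2021.AppendixC (C5.OpenCompactSubgroup C5.SmallLevel)
open Literature.NumberTheory.Adeles (latticeOfGL)
open Literature.NumberTheory.ComplexMultiplication (reflexNormFiniteIdele)
open Literature.NumberTheory.ComplexMultiplication.CMTypeOps (flip bar)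
open Literature.AlgebraicGeometry.Motives (CMType)
open Literature.AlgebraicGeometry.ShimuraVarieties.UnitaryCanonicalModel.Aux (torusFinAdelic reflexField numberField_reflexField)
open Summit.HodgeConjecture.HodgeConjecture.Cruxes.HLiu418.F0P6aPELWitnessE (GSAdele IsCMTypeThrough mOf AuxChartGS)
open Summit.HodgeConjecture.HodgeConjecture.Cruxes.HLiu418.F0P6aStubE6 (Reads RingActionReading)
open Summit.HodgeConjecture.HodgeConjecture.Cruxes.HLiu418.F0P6aChartFramePin (IsChartOfFrame)
open Summit.HodgeConjecture.HodgeConjecture.Theorems.F0P6aSerreTensorFibreMarkedAtSiegelPoint (exists_markedSerreTensorFibre_principal)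
open Summit.HodgeConjecture.HodgeConjecture.Theorems.F0P6aSpecialFibreConjugationCentralTwist (exists_cmConjHom_intertwines_of_centralTwist)

variable {F : Type} [Field F] [NumberField F] [IsCMField F] {ι₁ : F →+* ℂ} {Jstar : Matrix (Fin 2) (Fin 2) F}
  {K₀ : C5.OpenCompactSubgroup (GSAdele F Jstar)} {S : RecordSystemGS F Jstar ι₁ K₀} {Kc : C5.SmallLevel K₀}
  {Fi : Type} [Field Fi] [NumberField Fi] [Algebra F Fi] {τE : Fi →+* ℂ} {Φ : Set (F →+* ℂ)}

/-! ### §0 A sheet point as a `τE`-point -/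

omit [NumberField F] [IsCMField F] [NumberField Fi] in
/-- **The sheet point `ℓ_{eE}(Q)` is a `τE`-point of `X = M ⊗_F Fᵢ`** when `eE = τE` pointwise: its underlying morphism composed with the structure map
`X → Spec Fᵢ` is `Spec τE` (★ `thickeningLift_left_comp_snd`). [cite: GortzWedhorn2020, §(4.8)–(4.9)] -/
theorem thickeningLift_left_comp_hom_eq (Y : SchemeOver F) (eE : letI : Algebra F ℂ := ι₁.toAlgebra; Fi →ₐ[F] ℂ)
    (heE : ∀ x : Fi, eE x = τE x) (Q : letI : Algebra F ℂ := ι₁.toAlgebra; ComplexPoints Y) :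
    letI : Algebra F ℂ := ι₁.toAlgebra
    letI : Algebra Fi ℂ := τE.toAlgebra
    (thickeningLift eE Y Q).left ≫ ((Literature.AlgebraicGeometry.Motives.baseChange F Fi).obj Y).hom =
      Spec.map (CommRingCat.ofHom (algebraMap Fi ℂ)) := by
  letI : Algebra F ℂ := ι₁.toAlgebra
  letI : Algebra Fi ℂ := τE.toAlgebra
  have he : (eE : Fi →+* ℂ) = algebraMap Fi ℂ := RingHom.ext fun x => heE x
  change (thickeningLift eE Y Q).left ≫ pullback.snd Y.hom (bcSpec F Fi) = _
  rw [Literature.AlgebraicGeometry.Motives.thickeningLift_left_comp_snd, he]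

/-! ### §1 THE HEAD -/

set_option maxHeartbeats 800000 in -- the statement re-binds σ1-UNPACK twice, #42 §2 and ★ p850737 (≈ 40 conjuncts); proof is assembly only
/-- **(B3-SRC) — THE (R-CM) INPUTS AT A SPECIAL SHEET POINT** (see the module docstring for the dictionary with ★ p850815՚s binders).  For a special point
`(w, a)` and a sheet `eE = τE`: `σ = γ̃` over `ℚ`, an `F`-correspondent `s` of `σ`, the diagonal twist `d` at `w`; σ1՚s principal marking of `P_{x₁}`,
`x₁ := ℓ_{eE}(pts⁻¹[ι₁w, d⁻¹a])` (`m₁, Θ₁, Λ₁` + readings); the eight names of `B_{x₂}`, `x₂ := ℓ_{eE}(pts⁻¹[ι₁w, a])` (★ p850866 §2); and the CM homomorphism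
`f : (P_{x₁})^σ ⟶ B_{x₂}` with its `K_δ(N)`-twisted torsion reading and the intertwining for every `b ∈ 𝒪_F` (★ p850737).
[cite: Shimura1998, §18.6 pp. 124–128] [cite: Milne2005ShimuraVarieties, Def. 12.8 (59)–(62) p. 114, Thm. 13.6 p. 118, §14 Prop. 14.12 p. 125] [cite: RapoportSmithlingZhang2020Diagonal, §3.2 p. 11] -/
theorem exists_cmConjHom_at_specialSheetPoint [IsGalois ℚ F]
    (hJ : (Jstar.map (IsCMField.complexConj F))ᵀ = Jstar) (hΦ : IsCMTypeThrough ι₁ Φ)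
    (C : AuxChartGS F ι₁ Jstar K₀ S Kc Fi τE Φ) {ξ : F} {kFr : ℕ} {Fr : SymplecticFrameV F (RingHom.id F) Jstar ((kFr : ℚ) • ξ) C.g C.δ}
    (hpin : IsChartOfFrame hΦ C ξ kFr Fr)
    (ε : (Literature.AlgebraicGeometry.Motives.baseChange F Fi).obj (S.M.obj Kc) ⟶
        (Literature.AlgebraicGeometry.Motives.baseChange ℚ Fi).obj C.𝓜.M)
    (ρ : AbelianSchemeOver.RingAction (𝓞 F) (C.𝓜.univ.baseChange (ε.left ≫ pullback.fst C.𝓜.M.hom (bcSpec ℚ Fi))).A)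
    [IsCommMonObj (C.𝓜.univ.baseChange (ε.left ≫ pullback.fst C.𝓜.M.hom (bcSpec ℚ Fi))).A.X]
    (hρ : RingActionReading C ε ρ)
    -- the junction `IsSheetTwistOf ι₁ τE Φ hΦ C.N γ₁ 𝔞 n`, unfolded: the lift `γ̃`, the reflex correspondent `sE`, the idèle `z = t(sE)` with `[z] = 𝔞⁻¹`
    (γ₁ : Fi ≃ₐ[F] Fi) (𝔞 : Ideal (𝓞 F)) (h𝔞 : 𝔞 ≠ ⊥)
    (γ' : ℂ ≃+* ℂ) (hγ'τ : ∀ x : Fi, γ' (τE x) = τE (γ₁ x)) (hγ'F : ∀ x : F, γ' (ι₁ x) = ι₁ x)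
    (sE : letI := numberField_reflexField F (flip ι₁ (bar (⟨Φ, hΦ.2⟩ : CMType F))) ι₁
      (FiniteAdeleRing (𝓞 ↥(reflexField F (flip ι₁ (bar (⟨Φ, hΦ.2⟩ : CMType F))) ι₁))
        ↥(reflexField F (flip ι₁ (bar (⟨Φ, hΦ.2⟩ : CMType F))) ι₁))ˣ)
    (hsE : letI := numberField_reflexField F (flip ι₁ (bar (⟨Φ, hΦ.2⟩ : CMType F))) ι₁
      IsArtinCorrespondent ↥(reflexField F (flip ι₁ (bar (⟨Φ, hΦ.2⟩ : CMType F))) ι₁)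
        (algebraMap ↥(reflexField F (flip ι₁ (bar (⟨Φ, hΦ.2⟩ : CMType F))) ι₁) ℂ) sE γ')
    (z : (FiniteAdeleRing (𝓞 F) F)ˣ)
    (hzs : letI := numberField_reflexField F (flip ι₁ (bar (⟨Φ, hΦ.2⟩ : CMType F))) ι₁
      z = reflexNormFiniteIdele F (flip ι₁ (bar (⟨Φ, hΦ.2⟩ : CMType F))) (reflexField F (flip ι₁ (bar (⟨Φ, hΦ.2⟩ : CMType F))) ι₁) sE)
    (hz𝔞 : FiniteAdeleRing.toFractionalIdeal (𝓞 F) F z = ((𝔞 : FractionalIdeal (𝓞 F)⁰ F))⁻¹)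
    -- the Serre presentation of `𝔞` with scalar `ν` (★ p850615's rows)
    {mS : ℕ} (E' : Matrix (Fin mS) (Fin mS) (𝓞 F)) (hE' : E' * E' = E') (Pm : Matrix (Fin mS) (Fin 1) (𝓞 F)) (Qm : Matrix (Fin 1) (Fin mS) (𝓞 F))
    {ν : ℕ} (hν : ν ≠ 0) (hP : E' * Pm = Pm) (hQ : Qm * E' = Qm) (hQP : Qm * Pm = Matrix.scalar (Fin 1) ((ν : ℕ) : 𝓞 F))
    (hPQ : Pm * Qm = Matrix.scalar (Fin mS) ((ν : ℕ) : 𝓞 F) * E') (hspan : Ideal.span (Set.range fun j => Pm j 0) = 𝔞)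
    -- the sheet and the special point
    (eE : letI : Algebra F ℂ := ι₁.toAlgebra; Fi →ₐ[F] ℂ) (heE : ∀ x : Fi, eE x = τE x)
    (w : Fin 2 → F) (hw : (fun i => ι₁ (w i)) ∈ negCone (Jstar.map ι₁)) (a : GSAdele F Jstar) :
    letI P := C.𝓜.univ.baseChange (ε.left ≫ pullback.fst C.𝓜.M.hom (bcSpec ℚ Fi))
    letI : Algebra F ℂ := ι₁.toAlgebra
    haveI := isMonHom_serreTranslate ρ E' hE' Pm
    ∃ (σ : ℂ ≃ₐ[ℚ] ℂ) (_ : ∀ y : F, σ (ι₁ y) = ι₁ y) (_ : ∀ x : Fi, σ (eE x) = eE (γ₁ x)) (_ : σ.toRingEquiv = γ')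
      (s : (FiniteAdeleRing (𝓞 F) F)ˣ) (_ : IsArtinCorrespondent F ι₁ s σ.toRingEquiv)
      (d : GSAdele F Jstar) (_ : IsDiagTwistGS F Jstar w (recipFactor F s) d),
      -- the two sheet points as `τE`-points of `X` (underlying morphisms `(ℓ_{eE} z₀).left`, `(ℓ_{eE} z₁).left` BY `rfl`)
      letI : Algebra Fi ℂ := τE.toAlgebra
      letI x₂ : ComplexPoints ((Literature.AlgebraicGeometry.Motives.baseChange F Fi).obj (S.M.obj Kc)) :=
        AlgPoints.mk (thickeningLift eE (S.M.obj Kc) ((S.pts Kc).symm (ShimuraSetGS.mk F Jstar ι₁ Kc.1.1 (fun i => ι₁ (w i)) hw a))).left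
          (thickeningLift_left_comp_hom_eq (S.M.obj Kc) eE heE _)
      letI x₁ : ComplexPoints ((Literature.AlgebraicGeometry.Motives.baseChange F Fi).obj (S.M.obj Kc)) :=
        AlgPoints.mk (thickeningLift eE (S.M.obj Kc) ((S.pts Kc).symm (ShimuraSetGS.mk F Jstar ι₁ Kc.1.1 (fun i => ι₁ (w i)) hw (d⁻¹ * a)))).left
          (thickeningLift_left_comp_hom_eq (S.M.obj Kc) eE heE _)
      ∃ -- σ1 at the SOURCE `x₁`
        (v₁ : Fin 2 → ℂ) (hv₁ : v₁ ∈ negCone (Jstar.map ι₁)) (a₁ : GSAdele F Jstar)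
        (m₁ : SiegelAdelicMarking ⟨SiegelModuli.jOfSiegel C.δ (C.Z a₁ v₁), SiegelComplexRecordSystem.jOfSiegel_mem_C0pm C.hδ.1 (C.Z_mem a₁ v₁ hv₁)⟩
          (C.rep (C.piece a₁)) (P.A.fibre x₁.left).toAbelianVariety)
        (Θ₁ : Literature.AlgebraicGeometry.Motives.CartierDivisor (P.A.fibre x₁.left).toAbelianVariety.X.left)
        (Λ₁ : P.level.SymplecticLift x₁.left Θ₁ C.δ)
        -- σ1 and the eight names at the TARGET `x₂`
        (v₂ : Fin 2 → ℂ) (hv₂ : v₂ ∈ negCone (Jstar.map ι₁)) (a₂ : GSAdele F Jstar)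
        (m₀ : SiegelAdelicMarking ⟨SiegelModuli.jOfSiegel C.δ (C.Z a₂ v₂), SiegelComplexRecordSystem.jOfSiegel_mem_C0pm C.hδ.1 (C.Z_mem a₂ v₂ hv₂)⟩
          (C.rep (C.piece a₂)) (P.A.fibre x₂.left).toAbelianVariety)
        (Θ₂ : Literature.AlgebraicGeometry.Motives.CartierDivisor (P.A.fibre x₂.left).toAbelianVariety.X.left)
        (Λ₂ : P.level.SymplecticLift x₂.left Θ₂ C.δ)
        (Z₂ : Matrix (Fin C.g) (Fin C.g) ℂ) (hZ₂ : Z₂ ∈ siegelUpperHalfSpace C.g) (r₂ : ↥(gspFinAdelic C.δ))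
        (m₂ : SiegelAdelicMarking ⟨SiegelModuli.jOfSiegel C.δ Z₂, SiegelComplexRecordSystem.jOfSiegel_mem_C0pm C.hδ.1 hZ₂⟩ r₂
          ((serreTensor ρ E' hE').fibre x₂.left).toAbelianVariety)
        (q' qm : ↥(gspRational C.δ)) (M₂ : 𝓞 F → Matrix (Fin C.g ⊕ Fin C.g) (Fin C.g ⊕ Fin C.g) ℤ)
        -- the CM homomorphism and its level twist
        (f : ((P.A.fibre x₁.left).toAbelianVariety).conjugate σ.toRingEquiv ⟶ ((serreTensor ρ E' hE').fibre x₂.left).toAbelianVariety)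
        (k : ↥(gspFinAdelic C.δ)),
        -- SOURCE clauses
        ShimuraSetGS.mk F Jstar ι₁ Kc.1.1 v₁ hv₁ a₁ = ShimuraSetGS.mk F Jstar ι₁ Kc.1.1 (fun i => ι₁ (w i)) hw (d⁻¹ * a) ∧
        Θ₁.IsAmple ∧ P.A.IsLambdaOfAt x₁.left P.D P.pol.lam Θ₁ ∧
        (∀ ⦃M : ℕ⦄, C.N ∣ M → M ≠ 0 → ∀ (y : Fin C.g ⊕ Fin C.g → ZMod M) (u : Fin C.g ⊕ Fin C.g → ℚ),
          AdelicCongr (((C.rep (C.piece a₁))⁻¹ : ↥(gspFinAdelic C.δ)) : GL (Fin C.g ⊕ Fin C.g) finAdeleQ) 1 u (fun i => ((y i).val : ℚ) / M) →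
            ((Λ₁.lift M (Multiplicative.ofAdd y)) : (P.A.fibre x₁.left).toAbelianVariety.Points ℂ) = m₁.r u) ∧
        m₁.γ = 1 ∧ (∀ u : Fin C.g ⊕ Fin C.g → ℝ, m₁.Ψ u = siegelPeriodMap C.δ (C.Z a₁ v₁) u) ∧
        (P.A.baseChange x₁.left).IsOfRelDim C.g ∧
        (∀ (b : 𝓞 F) (u : Fin C.g ⊕ Fin C.g → ℚ),
          haveI := ρ.isMonHom b
          AlgPoints.map (fibreHom (ρ.i b) x₁.left).hom.hom.hom (m₁.r u) = m₁.r (((C.Mρ a₁ b).map (Int.cast : ℤ → ℚ)) *ᵥ u)) ∧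
        -- TARGET clauses (★ p850866 §2 verbatim at `x₂`)
        ShimuraSetGS.mk F Jstar ι₁ Kc.1.1 v₂ hv₂ a₂ = ShimuraSetGS.mk F Jstar ι₁ Kc.1.1 (fun i => ι₁ (w i)) hw a ∧
        Θ₂.IsAmple ∧ P.A.IsLambdaOfAt x₂.left P.D P.pol.lam Θ₂ ∧
        (∀ ⦃M : ℕ⦄, C.N ∣ M → M ≠ 0 → ∀ (y : Fin C.g ⊕ Fin C.g → ZMod M) (u : Fin C.g ⊕ Fin C.g → ℚ),
          AdelicCongr (((C.rep (C.piece a₂))⁻¹ : ↥(gspFinAdelic C.δ)) : GL (Fin C.g ⊕ Fin C.g) finAdeleQ) 1 u (fun i => ((y i).val : ℚ) / M) →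
            ((Λ₂.lift M (Multiplicative.ofAdd y)) : (P.A.fibre x₂.left).toAbelianVariety.Points ℂ) = m₀.r u) ∧
        m₀.γ = 1 ∧ (∀ u : Fin C.g ⊕ Fin C.g → ℝ, m₀.Ψ u = siegelPeriodMap C.δ (C.Z a₂ v₂) u) ∧
        (P.A.baseChange x₂.left).IsOfRelDim C.g ∧
        (∀ (b : 𝓞 F) (u : Fin C.g ⊕ Fin C.g → ℚ),
          haveI := ρ.isMonHom b
          AlgPoints.map (fibreHom (ρ.i b) x₂.left).hom.hom.hom (m₀.r u) = m₀.r (((C.Mρ a₂ b).map (Int.cast : ℤ → ℚ)) *ᵥ u)) ∧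
        r₂ ∈ principalLevelSubgroup C.δ 1 ∧
        q' = C.q a₂ * qm ∧
        conjJ (((gspRationalToReal C.δ q')⁻¹ : ↥(gspReal C.δ)) : GL (Fin C.g ⊕ Fin C.g) ℝ) (C.J v₂) = SiegelModuli.jOfSiegel C.δ Z₂ ∧
        gspRationalToFinAdelic C.δ q' • ((r₂ : ↥(gspFinAdelic C.δ)) : ↥(gspFinAdelic C.δ) ⧸ principalLevelSubgroup C.δ C.N) =
          ((C.b a₂ * auxToGspFinV Fr (1, (⟨z, hzs ▸
              Literature.AlgebraicGeometry.ShimuraVarieties.UnitaryCanonicalModel.Aux.reflexNormFiniteIdele_mem_torusFinAdelic F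
                (flip ι₁ (bar (⟨Φ, hΦ.2⟩ : CMType F))) ι₁ sE⟩ : ↥(torusFinAdelic F))) : ↥(gspFinAdelic C.δ)) :
            ↥(gspFinAdelic C.δ) ⧸ principalLevelSubgroup C.δ C.N) ∧
        (∀ b : 𝓞 F, (M₂ b).map (Int.cast : ℤ → ℚ) =
          (((q'⁻¹ : ↥(gspRational C.δ)) : GL (Fin C.g ⊕ Fin C.g) ℚ) : Matrix (Fin C.g ⊕ Fin C.g) (Fin C.g ⊕ Fin C.g) ℚ) * (C.ρ₀ b).map (Int.cast : ℤ → ℚ) *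
            (((q' : ↥(gspRational C.δ)) : GL (Fin C.g ⊕ Fin C.g) ℚ) : Matrix (Fin C.g ⊕ Fin C.g) (Fin C.g ⊕ Fin C.g) ℚ)) ∧
        (∀ (b : 𝓞 F) (u : Fin C.g ⊕ Fin C.g → ℚ),
          haveI := (serreAction ρ E' hE').isMonHom b
          AlgPoints.map (fibreHom ((serreAction ρ E' hE').i b) x₂.left).hom.hom.hom (m₂.r u) = m₂.r (((M₂ b).map (Int.cast : ℤ → ℚ)) *ᵥ u)) ∧
        (∀ u : Fin C.g ⊕ Fin C.g → ℚ, m₂.r u =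
          AlgPoints.map (fibreHom (serreTranslate ρ E' hE' Pm) x₂.left).hom.hom.hom
            (m₀.r ((((qm : ↥(gspRational C.δ)) : GL (Fin C.g ⊕ Fin C.g) ℚ) : Matrix (Fin C.g ⊕ Fin C.g) (Fin C.g ⊕ Fin C.g) ℚ) *ᵥ u))) ∧
        -- THE CM HOMOMORPHISM: level twist, torsion reading, intertwining
        k ∈ principalLevelSubgroup C.δ C.N ∧
        (∀ v₀ w₀ : Fin C.g ⊕ Fin C.g → ℚ,
          AdelicCongr ((k * (C.rep (C.piece a₁))⁻¹ : ↥(gspFinAdelic C.δ)) : GL (Fin C.g ⊕ Fin C.g) finAdeleQ)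
              ((r₂⁻¹ : ↥(gspFinAdelic C.δ)) : GL (Fin C.g ⊕ Fin C.g) finAdeleQ) v₀ w₀ →
            AlgPoints.map f.hom.hom.hom (((P.A.fibre x₁.left).toAbelianVariety).conjPoints σ.toRingEquiv (m₁.r v₀)) = m₂.r w₀) ∧
        ∀ b : 𝓞 F,
          haveI := ρ.isMonHom b
          haveI := (serreAction ρ E' hE').isMonHom b
          Literature.AlgebraicGeometry.Motives.AbelianVariety.Hom.conjugate σ.toRingEquiv (fibreHom (ρ.i b) x₁.left) ≫ f =
            f ≫ fibreHom ((serreAction ρ E' hE').i b) x₂.left := by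
  letI iF : Algebra F ℂ := ι₁.toAlgebra
  letI iFi : Algebra Fi ℂ := τE.toAlgebra
  haveI hc₀ : IsMonHom (serreTranslate ρ E' hE' Pm) := isMonHom_serreTranslate ρ E' hE' Pm
  haveI iE : NumberField ↥(reflexField F (flip ι₁ (bar (⟨Φ, hΦ.2⟩ : CMType F))) ι₁) :=
    numberField_reflexField F (flip ι₁ (bar (⟨Φ, hΦ.2⟩ : CMType F))) ι₁
  -- (1) `σ := γ̃` over `ℚ` and over `F`
  let σ : ℂ ≃ₐ[ℚ] ℂ := AlgEquiv.ofRingEquiv (f := γ') (fun q => by rw [eq_ratCast, map_ratCast])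
  have hσeq : σ.toRingEquiv = γ' := rfl
  have hσF : ∀ y : F, σ (ι₁ y) = ι₁ y := fun y => hγ'F y
  have hσγ : ∀ x : Fi, σ (eE x) = eE (γ₁ x) := fun x => by
    change γ' (eE x) = eE (γ₁ x)
    rw [heE, heE]; exact hγ'τ x
  let σF : ℂ ≃ₐ[F] ℂ := AlgEquiv.ofRingEquiv (f := γ') (fun y => hγ'F y)
  -- (2) an `F`-correspondent `s` of `σ` and the diagonal twist `d` at `w`
  have hsx := exists_finiteIdele_isArtinCorrespondent_algEquiv F ι₁ σF
  obtain ⟨s, hs⟩ := hsx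
  have hs' : IsArtinCorrespondent F ι₁ s σ.toRingEquiv := hs
  have hdx := exists_isDiagTwistGS_recipFactor' F Jstar hJ (hermForm_self_ne_zero_of_embedding_mem_negCone hw) s
  obtain ⟨d, hd⟩ := hdx
  -- (3) the torus element `z = t(sE) ∈ T(𝔸_f)`
  have hzT : z ∈ torusFinAdelic F :=
    hzs ▸ Literature.AlgebraicGeometry.ShimuraVarieties.UnitaryCanonicalModel.Aux.reflexNormFiniteIdele_mem_torusFinAdelic F
      (flip ι₁ (bar (⟨Φ, hΦ.2⟩ : CMType F))) ι₁ sE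
  let zT : ↥(torusFinAdelic F) := ⟨z, hzT⟩
  have hzT' : (zT : (FiniteAdeleRing (𝓞 F) F)ˣ) =
      reflexNormFiniteIdele F (flip ι₁ (bar (⟨Φ, hΦ.2⟩ : CMType F))) (reflexField F (flip ι₁ (bar (⟨Φ, hΦ.2⟩ : CMType F))) ι₁) sE := hzs
  have hz𝔞' : FiniteAdeleRing.toFractionalIdeal (𝓞 F) F (zT : (FiniteAdeleRing (𝓞 F) F)ˣ) = ((𝔞 : FractionalIdeal (𝓞 F)⁰ F))⁻¹ := hz𝔞
  -- (4) the two sheet points as `τE`-points (same underlying morphisms as `ℓ_{eE}`)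
  let z₀ : ComplexPoints (S.M.obj Kc) := (S.pts Kc).symm (ShimuraSetGS.mk F Jstar ι₁ Kc.1.1 (fun i => ι₁ (w i)) hw a)
  let z₁ : ComplexPoints (S.M.obj Kc) := (S.pts Kc).symm (ShimuraSetGS.mk F Jstar ι₁ Kc.1.1 (fun i => ι₁ (w i)) hw (d⁻¹ * a))
  let x₂ : ComplexPoints ((Literature.AlgebraicGeometry.Motives.baseChange F Fi).obj (S.M.obj Kc)) :=
    AlgPoints.mk (thickeningLift eE (S.M.obj Kc) z₀).left (thickeningLift_left_comp_hom_eq (S.M.obj Kc) eE heE z₀)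
  let x₁ : ComplexPoints ((Literature.AlgebraicGeometry.Motives.baseChange F Fi).obj (S.M.obj Kc)) :=
    AlgPoints.mk (thickeningLift eE (S.M.obj Kc) z₁).left (thickeningLift_left_comp_hom_eq (S.M.obj Kc) eE heE z₁)
  have hx₂ : z₀.left = x₂.left ≫ pullback.fst (S.M.obj Kc).hom (bcSpec F Fi) :=
    (Literature.AlgebraicGeometry.Motives.thickeningLift_left_comp_fst eE (S.M.obj Kc) z₀).symm
  have hx₁ : z₁.left = x₁.left ≫ pullback.fst (S.M.obj Kc).hom (bcSpec F Fi) :=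
    (Literature.AlgebraicGeometry.Motives.thickeningLift_left_comp_fst eE (S.M.obj Kc) z₁).symm
  -- (5) ★ p850866 §2 at the TARGET `x₂`
  have h2 := exists_markedSerreTensorFibre_principal hΦ C ξ kFr Fr hpin ε ρ hρ x₂ z₀ hx₂ 𝔞 h𝔞 zT hz𝔞' E' hE' Pm Qm hν hP hQ hQP hPQ hspan
  obtain ⟨v₂, h2⟩ := h2
  obtain ⟨hv₂, h2⟩ := h2
  obtain ⟨a₂, h2⟩ := h2
  obtain ⟨m₀, h2⟩ := h2
  obtain ⟨Θ₂, h2⟩ := h2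
  obtain ⟨Λ₂, h2⟩ := h2
  obtain ⟨Z₂, h2⟩ := h2
  obtain ⟨hZ₂, h2⟩ := h2
  obtain ⟨r₂, h2⟩ := h2
  obtain ⟨m₂, h2⟩ := h2
  obtain ⟨q', h2⟩ := h2
  obtain ⟨qm, h2⟩ := h2
  obtain ⟨M₂, h2⟩ := h2
  obtain ⟨hpts₂, hample₂, hlam₂, hlvl₂, hγ₂, hΨ₂, hA₂, hy₀, hr₂, hq'eq, hJ₂, hq', hM₂, hy₂, hm₂⟩ := h2
  -- (6) ★ p850866 §2 at the SOURCE `x₁` (only its σ1 half is used)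
  have h1 := exists_markedSerreTensorFibre_principal hΦ C ξ kFr Fr hpin ε ρ hρ x₁ z₁ hx₁ 𝔞 h𝔞 zT hz𝔞' E' hE' Pm Qm hν hP hQ hQP hPQ hspan
  obtain ⟨v₁, h1⟩ := h1
  obtain ⟨hv₁, h1⟩ := h1
  obtain ⟨a₁, h1⟩ := h1
  obtain ⟨m₁, h1⟩ := h1
  obtain ⟨Θ₁, h1⟩ := h1
  obtain ⟨Λ₁, h1⟩ := h1
  obtain ⟨_Z₁, h1⟩ := h1
  obtain ⟨_hZ₁, h1⟩ := h1
  obtain ⟨_r₁, h1⟩ := h1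
  obtain ⟨_m₁', h1⟩ := h1
  obtain ⟨_q₁, h1⟩ := h1
  obtain ⟨_qm₁, h1⟩ := h1
  obtain ⟨_M₁, h1⟩ := h1
  obtain ⟨hpts₁, hample₁, hlam₁, hlvl₁, hγ₁', hΨ₁, hA₁, hy₁, -⟩ := h1
  -- the two classes: `pts z₀ = [ι₁w, a]`, `pts z₁ = [ι₁w, d⁻¹a]`
  have hcl₂ : ShimuraSetGS.mk F Jstar ι₁ Kc.1.1 v₂ hv₂ a₂ = ShimuraSetGS.mk F Jstar ι₁ Kc.1.1 (fun i => ι₁ (w i)) hw a := by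
    rw [← hpts₂]; exact (S.pts Kc).apply_symm_apply _
  have hcl₁ : ShimuraSetGS.mk F Jstar ι₁ Kc.1.1 v₁ hv₁ a₁ = ShimuraSetGS.mk F Jstar ι₁ Kc.1.1 (fun i => ι₁ (w i)) hw (d⁻¹ * a) := by
    rw [← hpts₁]; exact (S.pts Kc).apply_symm_apply _
  have h₂' : ShimuraSetGS.mk F Jstar ι₁ Kc.1.1 v₂ hv₂ a₂ = ShimuraSetGS.mk F Jstar ι₁ Kc.1.1 (fun i => ι₁ (w i)) hw (d * (d⁻¹ * a)) := by
    rw [mul_inv_cancel_left]; exact hcl₂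
  -- (7) ★ p850737 (R-CM-1)+(R-CM-2) at `a₀ := d⁻¹·a`, `A₂ := B_{x₂}`, `act₂ b := ((serreAction …).i b)_{x₂}`
  have hR := exists_cmConjHom_intertwines_of_centralTwist hJ hΦ C hpin ε ρ σ hσF sE hsE zT hzT' s hs' w hw d hd (d⁻¹ * a)
    x₁ v₁ hv₁ a₁ hcl₁ m₁ hy₁ v₂ hv₂ a₂ h₂' m₂ hr₂ q' hJ₂ hq' M₂ hM₂
    (fun b => haveI := (serreAction ρ E' hE').isMonHom b; fibreHom ((serreAction ρ E' hE').i b) x₂.left) hy₂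
  obtain ⟨f, hR⟩ := hR
  obtain ⟨k, hR⟩ := hR
  obtain ⟨hk, hf, hint⟩ := hR
  -- (8) assemble
  exact ⟨σ, hσF, hσγ, hσeq, s, hs', d, hd, v₁, hv₁, a₁, m₁, Θ₁, Λ₁, v₂, hv₂, a₂, m₀, Θ₂, Λ₂, Z₂, hZ₂, r₂, m₂, q', qm, M₂, f, k,
    hcl₁, hample₁, hlam₁, hlvl₁, hγ₁', hΨ₁, hA₁, hy₁, hcl₂, hample₂, hlam₂, hlvl₂, hγ₂, hΨ₂, hA₂, hy₀, hr₂, hq'eq, hJ₂, hq', hM₂, hy₂, hm₂,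
    hk, hf, hint⟩

end Summit.HodgeConjecture.HodgeConjecture.Theorems.F0P6aSpecialSheetPointCMHom

end
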